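import Summits.BirchSwinnertonDyer.BirchSwinnertonDyer.Theorems.AlignedTransportAtTwoMainConjectureOfRankZeroBSDAtTwoFineRoadCoinvCruxArch
import HarnessLib

/-!
# Route `AlignedTransportAtTwo`, crux C2 `MainConjectureOfRankZeroBSDAtTwo` (stmt-BirchSwinnertonDyer-22298):
# what the registered data stub K₂″ (`stub_katoCoinvDataQiAtTwo`) SAYS — it is Kato's `μ`-inequality at `2`

HONEST FRAMING (cell `bsd-f1-sign2`, WIDTH-5 attached prover seat `bsd-line-att-p3` gen 2, line `birth` of the
lead `bsd-line-att-p2`; BSD is NOT proved by any of this). THEOREMS ONLY; nothing asserted. A tightness pass on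
the registered stub K₂″ `stub_katoCoinvDataQiAtTwo : KatoCoinvDataQiAtTwo` of skeleton v4 (road (b″) with the
archimedean balance, `…FineRoadCoinvCruxArch`). That stub is an `∃` over abstract `Λ₀`-modules and maps
(Kato's row over `ℚ(ζ_{2^∞})` with `Δ`-action, an injective `Δ`-equivariant Coleman map with finite cokernel,
the even-branch zeta value `a + b = s·G₊`, the descent `fd`, the fine comparison `fy`, the balance
`ℓ(ker fy) ≤ ℓ(ker fd)`); PER DATUM `(D, Yd, G₊)` it is EQUIVALENT to one line:

  `ℓ_{(2)}(X(E/ℚ_∞)) ≤ ℓ_{(2)}(Λ/(G₊)) + ℓ_{(2)}(X₀(E/ℚ_∞))`   (+ `X(E/ℚ_∞)` finitely generated torsion),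

i.e. Kato's `μ`-inequality `μ(X) ≤ μ(L₂⁺) + μ(X₀)` at `p = 2` WITHOUT the Euler-system bound 12.5 (4).

* §1 bookkeeping: `1 ∉ (p)`, `ℓ(Λ/(s·G)) = ℓ(Λ/(G))` for `s ∉ (p)`.
* §2 FORWARD (`lengthAt_le_of_coinvDatum`, any prime `p`): the displayed data for target modules `X_D, X_Y`
  give `ℓ_{(p)}(X_D) ≤ ℓ_{(p)}(Λ/(a+b)) + ℓ_{(p)}(X_Y)` — the lead's `lengthAt_coinv_le_of_roadB2` plus the
  length bookkeeping of `fd`, `fy` and the balance; with `a + b = s·G`, `s ∉ (p)`: `ℓ(Λ/(a+b)) = ℓ(Λ/(G))`.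
* §3 THE INEQUALITY ROAD (direct, no data): `ℓ(X_D) ≤ ℓ(Λ/(G)) + ℓ(X_Y)`, `red G ≠ 0`, `ℓ(X_Y) = 0` ⟹
  `ℓ(X_D) = 0`; at the crux level `seedMuZeroAtTwo_of_muInequalityAtTwo` (modularity + Lim 2017 at `2` + the
  INEQUALITY for every seed datum + (A₂) ⟹ stub T) and `mainConjectureOfRankZeroBSDAtTwo_of_muInequalityAtTwo`
  (C2 BY NAME), and `muInequalityAtTwo_of_katoCoinvDataQiAtTwo` (the registered K₂″ ⟹ the inequality shape).
* The CONVERSE (an explicit junk model: the `∃`-shape certifies no provenance, the balance clause is absorbed)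
  and the per-datum `iff` at `2` are in the sibling file `…FineRoadCoinvDataJunk`.

RECOMMENDATION to the lead / planner (not a route edit): register the INEQUALITY (§3's hypothesis shape) as
the road-(b″) stub — it is implied by K₂″ (§3), suffices for T (§3), is one line, and is exactly the sentence a
typer must extract from Kato §17.13 over `ℚ(ζ_{2^∞})` + the descent; keep the data shape as the typer's
checklist. Conditional content unchanged: the inequality at `p = 2` is PRINT-pending-audit, (A₂) is OPEN.

References: K. Kato, Astérisque 295 (2004), Thm. 12.5 (4), §12.1, Thm. 17.4, Prop. 17.11, §17.13;
R. Greenberg, LNM 1716 (1999) §3–§4, Conj. 1.11; J. Coates, R. Sujatha, Math. Ann. 331 (2005) §3;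
M. F. Lim, Asian J. Math. 21 (2017) Thm. 3.5; L. Washington, GTM 83, §13.2.
-/

set_option linter.dupNamespace false
set_option autoImplicit false

noncomputable section

open scoped Classical

open Literature.NumberTheory.EllipticCurves Literature.NumberTheory.EllipticCurves.Module

namespace Summit.BirchSwinnertonDyer.BirchSwinnertonDyer.Theorems.AlignedTransportAtTwoFineRoad

/-! ## §1 Bookkeeping -/

section Bookkeeping

variable {p : ℕ} [Fact p.Prime]

/-- `1 ∉ (p)`. [folklore] -/
theorem one_not_mem_augIdealP : (1 : IwasawaAlgebra p) ∉ IwasawaAlgebra.augIdealP p := fun h =>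
  (IwasawaAlgebra.isPrime_augIdealP_holds p).ne_top ((Ideal.eq_top_iff_one _).mpr h)

/-- `s ∉ (p)` ⟹ `s ≠ 0`. [folklore] -/
theorem ne_zero_of_not_mem_augIdealP {s : IwasawaAlgebra p} (hs : s ∉ IwasawaAlgebra.augIdealP p) : s ≠ 0 :=
  fun h => hs (h ▸ Ideal.zero_mem _)

/-- For `s ∉ (p)`: `ℓ_{(p)}(Λ/(s·G)) = ℓ_{(p)}(Λ/(G))`. [folklore] -/
theorem lengthAt_quotient_span_mul_of_not_mem {s : IwasawaAlgebra p} (hs : s ∉ IwasawaAlgebra.augIdealP p)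
    (G : IwasawaAlgebra p) (𝔭 : PrimeSpectrum (IwasawaAlgebra p)) (h𝔭 : 𝔭.asIdeal = IwasawaAlgebra.augIdealP p) :
    lengthAt (IwasawaAlgebra p) (IwasawaAlgebra p ⧸ Ideal.span {s * G}) 𝔭 =
      lengthAt (IwasawaAlgebra p) (IwasawaAlgebra p ⧸ Ideal.span {G}) 𝔭 := by
  rw [lengthAt_quotient_span_singleton_mul G (ne_zero_of_not_mem_augIdealP hs) 𝔭,
    lengthAt_quotient_eq_zero_of_not_le (by rw [Ideal.span_singleton_le_iff_mem, h𝔭]; exact hs), zero_add]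

end Bookkeeping

/-! ## §2 Forward: the displayed data give the `μ`-inequality -/

section Forward

variable (p : ℕ) [Fact p.Prime]
  {P X' Y' XD XY : Type*} [AddCommGroup P] [_root_.Module (IwasawaAlgebra p) P]
  [AddCommGroup X'] [_root_.Module (IwasawaAlgebra p) X']
  [AddCommGroup Y'] [_root_.Module (IwasawaAlgebra p) Y']
  [AddCommGroup XD] [_root_.Module (IwasawaAlgebra p) XD]
  [AddCommGroup XY] [_root_.Module (IwasawaAlgebra p) XY]

/-- **FORWARD: road-(b″) data ⟹ the `μ`-inequality.** Over `Λ₀ = ℤ_p⟦T⟧` at `𝔭 = (p)`: a row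
`P → X' → Y' → 0` with `Δ`-action, an injective `Δ`-equivariant Coleman map `col : P → Λ₀²` with FINITE
cokernel, `w₁, w₂ ∈ ker toX` with `col w₁ = (a,b)`, `col w₂ = (b,a)`, `X'` finitely generated torsion, a map
`fd : X'_Δ → X_D` with finite cokernel, a map `fy : Y'_Δ → X_Y`, and the balance `ℓ(ker fy) ≤ ℓ(ker fd)` give
`ℓ_𝔭(X_D) ≤ ℓ_𝔭(Λ₀/(a+b)) + ℓ_𝔭(X_Y)`. (Read: `X_D = X(E/ℚ_∞)`, `X_Y = X₀(E/ℚ_∞)`, `a + b = s·G₊`: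
Kato's `μ(X) ≤ μ(L₂⁺) + μ(X₀)` without 12.5 (4).) [cite: Kato2004Asterisque, §12.1, Prop. 17.11, §17.13 (pp. 219–220, 277–280)]
[cite: GreenbergLNM1716, §3–§4] -/
theorem lengthAt_le_of_coinvDatum (𝔭 : PrimeSpectrum (IwasawaAlgebra p))
    (h𝔭 : 𝔭.asIdeal = IwasawaAlgebra.augIdealP p)
    (toX : P →ₗ[IwasawaAlgebra p] X') (π : X' →ₗ[IwasawaAlgebra p] Y') (hX : Function.Exact toX π)
    (hπ : Function.Surjective π) (cP : P →ₗ[IwasawaAlgebra p] P) (cX : X' →ₗ[IwasawaAlgebra p] X')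
    (cY : Y' →ₗ[IwasawaAlgebra p] Y') (hcX : toX ∘ₗ cP = cX ∘ₗ toX) (hcY : π ∘ₗ cX = cY ∘ₗ π)
    (col : P →ₗ[IwasawaAlgebra p] IwasawaAlgebra p × IwasawaAlgebra p) (hcol : Function.Injective col)
    (hccol : col ∘ₗ cP = (LinearEquiv.prodComm (IwasawaAlgebra p) (IwasawaAlgebra p) (IwasawaAlgebra p) :
      IwasawaAlgebra p × IwasawaAlgebra p →ₗ[IwasawaAlgebra p] IwasawaAlgebra p × IwasawaAlgebra p) ∘ₗ col)
    (hfin : Finite ((IwasawaAlgebra p × IwasawaAlgebra p) ⧸ LinearMap.range col))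
    {w₁ w₂ : P} (h₁ : toX w₁ = 0) (h₂ : toX w₂ = 0) {a b : IwasawaAlgebra p} (hw₁ : col w₁ = (a, b))
    (hw₂ : col w₂ = (b, a)) (hXfg : Module.Finite (IwasawaAlgebra p) X')
    (hXt : Module.IsTorsion (IwasawaAlgebra p) X')
    (fd : (X' ⧸ LinearMap.range (cX - 1)) →ₗ[IwasawaAlgebra p] XD) (hfd : Finite (XD ⧸ LinearMap.range fd))
    (fy : (Y' ⧸ LinearMap.range (cY - 1)) →ₗ[IwasawaAlgebra p] XY)
    (harch : lengthAt (IwasawaAlgebra p) (LinearMap.ker fy) 𝔭 ≤ lengthAt (IwasawaAlgebra p) (LinearMap.ker fd) 𝔭) :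
    lengthAt (IwasawaAlgebra p) XD 𝔭 ≤
      lengthAt (IwasawaAlgebra p) (IwasawaAlgebra p ⧸ Ideal.span {a + b}) 𝔭 + lengthAt (IwasawaAlgebra p) XY 𝔭 := by
  haveI := hfin
  haveI := hfd
  haveI := hXfg
  have hc : lengthAt (IwasawaAlgebra p) ((IwasawaAlgebra p × IwasawaAlgebra p) ⧸ LinearMap.range col) 𝔭 = 0 :=
    lengthAt_augIdealP_eq_zero_of_finite p _ 𝔭 h𝔭
  have h1 := lengthAt_coinv_le_of_roadB2 toX π hX hπ cP cX cY hcX hcY col hcol hccol h₁ h₂ hw₁ hw₂ 𝔭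
  rw [hc, zero_add] at h1
  have h2 := lengthAt_le_ker_add fy 𝔭
  have h3 : lengthAt (IwasawaAlgebra p) (X' ⧸ LinearMap.range (cX - 1)) 𝔭 =
      lengthAt (IwasawaAlgebra p) (LinearMap.ker fd) 𝔭 + lengthAt (IwasawaAlgebra p) (LinearMap.range fd) 𝔭 := by
    rw [lengthAt_eq_add_quotient (LinearMap.ker fd) 𝔭, lengthAt_eq_of_linearEquiv fd.quotKerEquivRange 𝔭]
  have h4 : lengthAt (IwasawaAlgebra p) XD 𝔭 = lengthAt (IwasawaAlgebra p) (LinearMap.range fd) 𝔭 := by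
    rw [lengthAt_eq_add_quotient (LinearMap.range fd) 𝔭,
      lengthAt_augIdealP_eq_zero_of_finite p (XD ⧸ LinearMap.range fd) 𝔭 h𝔭, add_zero]
  have hker_ne : lengthAt (IwasawaAlgebra p) (LinearMap.ker fd) 𝔭 ≠ ⊤ :=
    ne_top_of_le_ne_top
      (ne_top_of_le_ne_top (lengthAt_ne_top_of_isTorsion p X' hXt 𝔭 h𝔭) (lengthAt_quotient_le _ 𝔭))
      (lengthAt_submodule_le _ 𝔭)
  refine (ENat.add_le_add_iff_left hker_ne).mp ?_
  calc lengthAt (IwasawaAlgebra p) (LinearMap.ker fd) 𝔭 + lengthAt (IwasawaAlgebra p) XD 𝔭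
      = lengthAt (IwasawaAlgebra p) (X' ⧸ LinearMap.range (cX - 1)) 𝔭 := by rw [h4, ← h3]
    _ ≤ lengthAt (IwasawaAlgebra p) (IwasawaAlgebra p ⧸ Ideal.span {a + b}) 𝔭 +
          lengthAt (IwasawaAlgebra p) (Y' ⧸ LinearMap.range (cY - 1)) 𝔭 := h1
    _ ≤ lengthAt (IwasawaAlgebra p) (IwasawaAlgebra p ⧸ Ideal.span {a + b}) 𝔭 +
          (lengthAt (IwasawaAlgebra p) (LinearMap.ker fy) 𝔭 + lengthAt (IwasawaAlgebra p) XY 𝔭) := by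
        gcongr
    _ ≤ lengthAt (IwasawaAlgebra p) (IwasawaAlgebra p ⧸ Ideal.span {a + b}) 𝔭 +
          (lengthAt (IwasawaAlgebra p) (LinearMap.ker fd) 𝔭 + lengthAt (IwasawaAlgebra p) XY 𝔭) := by
        gcongr
    _ = lengthAt (IwasawaAlgebra p) (LinearMap.ker fd) 𝔭 +
          (lengthAt (IwasawaAlgebra p) (IwasawaAlgebra p ⧸ Ideal.span {a + b}) 𝔭 +
            lengthAt (IwasawaAlgebra p) XY 𝔭) := by
        rw [add_left_comm]

end Forward

/-! ## §3 The inequality road (direct) -/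

section InequalityRoad

open Summit.BirchSwinnertonDyer.Rank1Residual.X1.MuLambda

variable (p : ℕ) [Fact p.Prime]

/-- **THE INEQUALITY ROAD, per target pair.** `ℓ_{(p)}(X_D) ≤ ℓ_{(p)}(Λ/(G)) + ℓ_{(p)}(X_Y)` with `red G ≠ 0`
(`μ(G) = 0`) and `ℓ_{(p)}(X_Y) = 0` (statement (A)) give `ℓ_{(p)}(X_D) = 0`. [cite: Kato2004Asterisque, §17.13 (pp. 279–280)]
[cite: CoatesSujatha2005, statement (A) (§3)] -/
theorem lengthAt_eq_zero_of_muInequality {XD XY : Type*} [AddCommGroup XD] [_root_.Module (IwasawaAlgebra p) XD]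
    [AddCommGroup XY] [_root_.Module (IwasawaAlgebra p) XY] (𝔭 : PrimeSpectrum (IwasawaAlgebra p))
    (h𝔭 : 𝔭.asIdeal = IwasawaAlgebra.augIdealP p) {G : IwasawaAlgebra p} (hG : red G ≠ 0)
    (hY : lengthAt (IwasawaAlgebra p) XY 𝔭 = 0)
    (hle : lengthAt (IwasawaAlgebra p) XD 𝔭 ≤
      lengthAt (IwasawaAlgebra p) (IwasawaAlgebra p ⧸ Ideal.span {G}) 𝔭 + lengthAt (IwasawaAlgebra p) XY 𝔭) :
    lengthAt (IwasawaAlgebra p) XD 𝔭 = 0 := by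
  have hq : lengthAt (IwasawaAlgebra p) (IwasawaAlgebra p ⧸ Ideal.span {G}) 𝔭 = 0 :=
    lengthAt_quotient_eq_zero_of_not_le
      (by rw [Ideal.span_singleton_le_iff_mem, h𝔭]; exact not_mem_augIdealP_of_red_ne_zero hG)
  rw [hq, hY, add_zero] at hle
  exact nonpos_iff_eq_zero.mp hle

end InequalityRoad

section InequalityRoadCrux

open CongruenceSubgroup WeierstrassCurve Literature.NumberTheory.EllipticCurves.ModularForms
  Literature.NumberTheory.EllipticCurves.Greenberg1999
  Literature.NumberTheory.EllipticCurves.Rank1Residual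
  Literature.NumberTheory.IwasawaTheory
  Summit.BirchSwinnertonDyer.Rank1Residual Summit.BirchSwinnertonDyer.Rank1Residual.X1.MuLambda
  Summit.BirchSwinnertonDyer.Rank1Residual.X5 Summit.BirchSwinnertonDyer.Rank1Residual.F1Sign2
  Summit.BirchSwinnertonDyer.BirchSwinnertonDyer.Theorems.Rank1ResidualX1Defs
  Summit.BirchSwinnertonDyer.BirchSwinnertonDyer.Theses.AlignedTransportAtTwo

/-- **Stub T of line `birth` from the `μ`-INEQUALITY at `2`.** Modularity + Lim 2017 Thm. 3.5 at `2` + the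
displayed inequality `ℓ_{(2)}(X(W/ℚ_∞)) ≤ ℓ_{(2)}(Λ/(G₊)) + ℓ_{(2)}(X₀(W/ℚ_∞))` for every curve good ordinary at
`2` with no rational `2`-torsion, every cyclotomic datum, newform, integral lift `G₊` of `L₂(f, α)` and all dual
data (Kato's `μ`-inequality at `p = 2` without 12.5 (4): PRINT over `ℚ(ζ_{2^∞})` pending typing + the descent
audit; DISPLAYED, nothing asserted) + (A₂) classical `μ = 0` of a `2`-power-index subfield of `ℚ(W[4])` for every
seed ⟹ `SeedMuZeroAtTwo`. The even-branch binder `red G₊ ≠ 0` of the crux is load-bearing.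
[cite: Kato2004Asterisque, Thm. 17.4 and §17.13 (pp. 273–280)] [cite: Lim2017FineSelmer, §3 Thm. 3.5 and Lemma 3.2]
[cite: CoatesSujatha2005, statement (A) (§3)] [cite: GreenbergLNM1716, Conj. 1.11 (p. 58)] -/
theorem seedMuZeroAtTwo_of_muInequalityAtTwo (hmod : nonempty_modularParametrizationData)
    (hLim : Lim2017.thm35_at_two_fineSelmerDual_moduleFinite_of_classicalMuVanishes_of_le_divisionField_four)
    (hIneq : ∀ (W : WeierstrassCurve ℚ) [W.IsElliptic] [W.IsGloballyMinimal], IsOrdinaryAt W 2 →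
      (∀ x : ℚ, ¬ HasRationalTwoTorsionX W x) →
      ∀ (κ : ZpExtension ℚ 2) (γ : Field.absoluteGaloisGroup ℚ), κ.IsCyclotomic →
      κ.IsTopGenerator γ → IsCyclotomicVariable 2 γ →
      ∀ ⦃N : ℕ⦄ [NeZero N] (f : CuspForm (Gamma0 N) 2), IsNewformOf W f →
      ∀ Gp : IwasawaAlgebra 2, iwasawaToPowerSeries 2 Gp = padicLFunction f (unitRoot W 2 : ℚ_[2]) →
      ∀ (D : W.SelmerDualData κ γ) (Yd : W.FineSelmerDualData κ γ),
        lengthAt (IwasawaAlgebra 2) D.X ⟨IwasawaAlgebra.augIdealP 2, IwasawaAlgebra.isPrime_augIdealP_holds 2⟩ ≤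
          lengthAt (IwasawaAlgebra 2) (IwasawaAlgebra 2 ⧸ Ideal.span {Gp})
              ⟨IwasawaAlgebra.augIdealP 2, IwasawaAlgebra.isPrime_augIdealP_holds 2⟩ +
            lengthAt (IwasawaAlgebra 2) Yd.X ⟨IwasawaAlgebra.augIdealP 2, IwasawaAlgebra.isPrime_augIdealP_holds 2⟩)
    (hA2 : ∀ (W : WeierstrassCurve ℚ) [W.IsElliptic] [W.IsGloballyMinimal], ¬ W.HasCM →
      IsOrdinaryAt W 2 → (∀ x : ℚ, ¬ HasRationalTwoTorsionX W x) → ¬ IsSquare W.Δ →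
      W.analyticRank = 0 → BSDp W 2 →
      ∃ L : IntermediateField ℚ (AlgebraicClosure ℚ), L ≤ W.divisionField 4 ∧
        (∃ k : ℕ, Module.finrank ℚ (W.divisionField 4) = 2 ^ k * Module.finrank ℚ L) ∧
        ∀ κL : ZpExtension L 2, κL.IsCyclotomic → ClassicalMuVanishes κL) :
    ∀ (W : WeierstrassCurve ℚ) [W.IsElliptic] [W.IsGloballyMinimal], ¬ W.HasCM →
      IsOrdinaryAt W 2 → (∀ x : ℚ, ¬ HasRationalTwoTorsionX W x) → ¬ IsSquare W.Δ →
      W.analyticRank = 0 →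
      (∀ ⦃N : ℕ⦄ [NeZero N] (f : CuspForm (Gamma0 N) 2), IsNewformOf W f →
        ∀ G : IwasawaAlgebra 2, IsEvenBranchLiftAtTwo W f G → red G ≠ 0) →
      BSDp W 2 →
      ∀ (κ : ZpExtension ℚ 2) (γ : Field.absoluteGaloisGroup ℚ), κ.IsCyclotomic →
        κ.IsTopGenerator γ → IsCyclotomicVariable 2 γ →
        ∀ D : W.SelmerDualData κ γ, D.IsTorsion → D.mu = 0 := by
  intro W _ _ hcm hord ht hsq hr hμan hbsd κ γ hκ hγ hγ' D _
  let 𝔭 : PrimeSpectrum (IwasawaAlgebra 2) :=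
    ⟨IwasawaAlgebra.augIdealP 2, IwasawaAlgebra.isPrime_augIdealP_holds 2⟩
  have hirr : Irr W 2 := AlignedTransportAtTwoSeed.irr_two_of_forall_not_hasRationalTwoTorsionX W ht
  haveI : NeZero (W.conductorNorm ℤ) := ⟨(W.conductorNorm_pos_holds).ne'⟩
  obtain ⟨Dm⟩ := hmod W
  obtain ⟨Gp, hGp⟩ := exists_iwasawaToPowerSeries_eq_padicLFunction_two hord Dm.isNewformOf hirr
  have hred : red Gp ≠ 0 := hμan Dm.f Dm.isNewformOf Gp (Or.inl ⟨hord, hGp⟩)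
  let Yd : W.FineSelmerDualData κ γ := W.fineSelmerDualData κ hγ
  obtain ⟨L, hL, hidx, hμL⟩ := hA2 W hcm hord ht hsq hr hbsd
  have hA := finite_fineSelmer_twoTorsion_of_classicalMu W hLim L hL hidx hμL κ hκ
  have hY : lengthAt (IwasawaAlgebra 2) Yd.X 𝔭 = 0 :=
    lengthAt_fineSelmerDual_eq_zero_of_finite_twoTorsion W hγ Yd hA
  have hX0 : lengthAt (IwasawaAlgebra 2) D.X 𝔭 = 0 :=
    lengthAt_eq_zero_of_muInequality 2 𝔭 rfl hred hY (hIneq W hord ht κ γ hκ hγ hγ' Dm.f Dm.isNewformOf Gp hGp D Yd)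
  change muInvariant 2 D.X = 0
  rw [muInvariant_eq_toNat_lengthAt 2 D.X 𝔭 rfl, hX0]
  rfl

/-- **C2 BY NAME from the `μ`-inequality at `2`.** PRINT {Kato 17.4 (1)(2) at `2`, Greenberg 4.1, period unit,
modularity, GZK, Lim 2017 Thm. 3.5 at `2`} + the displayed `μ`-inequality at `2` + (A₂) ⟹
`MainConjectureOfRankZeroBSDAtTwo`. CONDITIONAL (inequality = print pending typing/audit; (A₂) open).
[cite: Kato2004Asterisque, Thm. 17.4 (p. 273) and §17.13 (pp. 279–280)] [cite: Lim2017FineSelmer, §3 Thm. 3.5 and Lemma 3.2]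
[cite: GreenbergLNM1716, Thm. 4.1 (p. 102) and Conj. 1.11 (p. 58)] -/
theorem mainConjectureOfRankZeroBSDAtTwo_of_muInequalityAtTwo
    (h17 : ∀ (V : WeierstrassCurve ℚ) [V.IsElliptic] [V.IsGloballyMinimal] [NeZero (V.conductorNorm ℤ)]
      (f : CuspForm (Gamma0 (V.conductorNorm ℤ)) 2), kato_divisibility_allPrimes V 2 (f := f))
    (hGr : Greenberg1999.thm41_charValue_rankZero_anyPrime)
    (hper : realPeriodRat_eq_unit_mul_plusPeriod_two) (hmod : nonempty_modularParametrizationData)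
    (hGZK : rank_eq_analyticRank_of_analyticRank_le_one)
    (hLim : Lim2017.thm35_at_two_fineSelmerDual_moduleFinite_of_classicalMuVanishes_of_le_divisionField_four)
    (hIneq : ∀ (W : WeierstrassCurve ℚ) [W.IsElliptic] [W.IsGloballyMinimal], IsOrdinaryAt W 2 →
      (∀ x : ℚ, ¬ HasRationalTwoTorsionX W x) →
      ∀ (κ : ZpExtension ℚ 2) (γ : Field.absoluteGaloisGroup ℚ), κ.IsCyclotomic →
      κ.IsTopGenerator γ → IsCyclotomicVariable 2 γ →
      ∀ ⦃N : ℕ⦄ [NeZero N] (f : CuspForm (Gamma0 N) 2), IsNewformOf W f →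
      ∀ Gp : IwasawaAlgebra 2, iwasawaToPowerSeries 2 Gp = padicLFunction f (unitRoot W 2 : ℚ_[2]) →
      ∀ (D : W.SelmerDualData κ γ) (Yd : W.FineSelmerDualData κ γ),
        lengthAt (IwasawaAlgebra 2) D.X ⟨IwasawaAlgebra.augIdealP 2, IwasawaAlgebra.isPrime_augIdealP_holds 2⟩ ≤
          lengthAt (IwasawaAlgebra 2) (IwasawaAlgebra 2 ⧸ Ideal.span {Gp})
              ⟨IwasawaAlgebra.augIdealP 2, IwasawaAlgebra.isPrime_augIdealP_holds 2⟩ +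
            lengthAt (IwasawaAlgebra 2) Yd.X ⟨IwasawaAlgebra.augIdealP 2, IwasawaAlgebra.isPrime_augIdealP_holds 2⟩)
    (hA2 : ∀ (W : WeierstrassCurve ℚ) [W.IsElliptic] [W.IsGloballyMinimal], ¬ W.HasCM →
      IsOrdinaryAt W 2 → (∀ x : ℚ, ¬ HasRationalTwoTorsionX W x) → ¬ IsSquare W.Δ →
      W.analyticRank = 0 → BSDp W 2 →
      ∃ L : IntermediateField ℚ (AlgebraicClosure ℚ), L ≤ W.divisionField 4 ∧
        (∃ k : ℕ, Module.finrank ℚ (W.divisionField 4) = 2 ^ k * Module.finrank ℚ L) ∧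
        ∀ κL : ZpExtension L 2, κL.IsCyclotomic → ClassicalMuVanishes κL) :
    MainConjectureOfRankZeroBSDAtTwo :=
  AlignedTransportAtTwoSeed.mainConjectureOfRankZeroBSDAtTwo_of_seedMuZero h17 hGr hper hmod hGZK
    (seedMuZeroAtTwo_of_muInequalityAtTwo hmod hLim hIneq hA2)

/-- **The registered stub K₂″ (`KatoCoinvDataQiAtTwo`, verbatim shape) ⟹ the `μ`-inequality at `2`** (the
hypothesis shape of `seedMuZeroAtTwo_of_muInequalityAtTwo`), datum by datum, by §2 and
`ℓ(Λ/(s·G₊)) = ℓ(Λ/(G₊))` for `s ∉ (2)`. [cite: Kato2004Asterisque, §12.1, Prop. 17.11, §17.13 (pp. 219–280)] -/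
theorem muInequalityAtTwo_of_katoCoinvDataQiAtTwo
    (hK2 : ∀ (W : WeierstrassCurve ℚ) [W.IsElliptic] [W.IsGloballyMinimal], IsOrdinaryAt W 2 →
      (∀ x : ℚ, ¬ HasRationalTwoTorsionX W x) →
      ∀ (κ : ZpExtension ℚ 2) (γ : Field.absoluteGaloisGroup ℚ), κ.IsCyclotomic →
      κ.IsTopGenerator γ → IsCyclotomicVariable 2 γ →
      ∀ ⦃N : ℕ⦄ [NeZero N] (f : CuspForm (Gamma0 N) 2), IsNewformOf W f →
      ∀ Gp : IwasawaAlgebra 2, iwasawaToPowerSeries 2 Gp = padicLFunction f (unitRoot W 2 : ℚ_[2]) →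
      ∀ (D : W.SelmerDualData κ γ) (Yd : W.FineSelmerDualData κ γ),
        ∃ (P X' Y' : Type) (_ : AddCommGroup P) (_ : _root_.Module (IwasawaAlgebra 2) P)
          (_ : AddCommGroup X') (_ : _root_.Module (IwasawaAlgebra 2) X')
          (_ : AddCommGroup Y') (_ : _root_.Module (IwasawaAlgebra 2) Y')
          (toX : P →ₗ[IwasawaAlgebra 2] X') (π : X' →ₗ[IwasawaAlgebra 2] Y')
          (cP : P →ₗ[IwasawaAlgebra 2] P) (cX : X' →ₗ[IwasawaAlgebra 2] X')
          (cY : Y' →ₗ[IwasawaAlgebra 2] Y')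
          (col : P →ₗ[IwasawaAlgebra 2] IwasawaAlgebra 2 × IwasawaAlgebra 2) (w₁ w₂ : P)
          (a b s : IwasawaAlgebra 2) (fd : (X' ⧸ LinearMap.range (cX - 1)) →ₗ[IwasawaAlgebra 2] D.X)
          (fy : (Y' ⧸ LinearMap.range (cY - 1)) →ₗ[IwasawaAlgebra 2] Yd.X),
          Function.Exact toX π ∧ Function.Surjective π ∧ toX ∘ₗ cP = cX ∘ₗ toX ∧ π ∘ₗ cX = cY ∘ₗ π ∧
          Function.Injective col ∧
          col ∘ₗ cP = (LinearEquiv.prodComm (IwasawaAlgebra 2) (IwasawaAlgebra 2) (IwasawaAlgebra 2) :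
            IwasawaAlgebra 2 × IwasawaAlgebra 2 →ₗ[IwasawaAlgebra 2]
              IwasawaAlgebra 2 × IwasawaAlgebra 2) ∘ₗ col ∧
          Finite ((IwasawaAlgebra 2 × IwasawaAlgebra 2) ⧸ LinearMap.range col) ∧
          toX w₁ = 0 ∧ toX w₂ = 0 ∧ col w₁ = (a, b) ∧ col w₂ = (b, a) ∧
          s ∉ IwasawaAlgebra.augIdealP 2 ∧ a + b = s * Gp ∧
          Module.Finite (IwasawaAlgebra 2) X' ∧ Module.IsTorsion (IwasawaAlgebra 2) X' ∧
          Finite (D.X ⧸ LinearMap.range fd) ∧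
          lengthAt (IwasawaAlgebra 2) (LinearMap.ker fy)
              ⟨IwasawaAlgebra.augIdealP 2, IwasawaAlgebra.isPrime_augIdealP_holds 2⟩ ≤
            lengthAt (IwasawaAlgebra 2) (LinearMap.ker fd)
              ⟨IwasawaAlgebra.augIdealP 2, IwasawaAlgebra.isPrime_augIdealP_holds 2⟩) :
    ∀ (W : WeierstrassCurve ℚ) [W.IsElliptic] [W.IsGloballyMinimal], IsOrdinaryAt W 2 →
      (∀ x : ℚ, ¬ HasRationalTwoTorsionX W x) →
      ∀ (κ : ZpExtension ℚ 2) (γ : Field.absoluteGaloisGroup ℚ), κ.IsCyclotomic →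
      κ.IsTopGenerator γ → IsCyclotomicVariable 2 γ →
      ∀ ⦃N : ℕ⦄ [NeZero N] (f : CuspForm (Gamma0 N) 2), IsNewformOf W f →
      ∀ Gp : IwasawaAlgebra 2, iwasawaToPowerSeries 2 Gp = padicLFunction f (unitRoot W 2 : ℚ_[2]) →
      ∀ (D : W.SelmerDualData κ γ) (Yd : W.FineSelmerDualData κ γ),
        lengthAt (IwasawaAlgebra 2) D.X ⟨IwasawaAlgebra.augIdealP 2, IwasawaAlgebra.isPrime_augIdealP_holds 2⟩ ≤
          lengthAt (IwasawaAlgebra 2) (IwasawaAlgebra 2 ⧸ Ideal.span {Gp})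
              ⟨IwasawaAlgebra.augIdealP 2, IwasawaAlgebra.isPrime_augIdealP_holds 2⟩ +
            lengthAt (IwasawaAlgebra 2) Yd.X
              ⟨IwasawaAlgebra.augIdealP 2, IwasawaAlgebra.isPrime_augIdealP_holds 2⟩ := by
  intro W _ _ hord ht κ γ hκ hγ hγ' N _ f hf Gp hGp D Yd
  obtain ⟨P, X', Y', _, _, _, _, _, _, toX, π, cP, cX, cY, col, w₁, w₂, a, b, s, fd, fy, hX, hπ, hcX, hcY,
    hcol, hccol, hfin, h₁, h₂, hw₁, hw₂, hs, hab, hXfg, hXt, hfd, harch⟩ :=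
    hK2 W hord ht κ γ hκ hγ hγ' f hf Gp hGp D Yd
  have h := lengthAt_le_of_coinvDatum 2 ⟨IwasawaAlgebra.augIdealP 2, IwasawaAlgebra.isPrime_augIdealP_holds 2⟩
    rfl toX π hX hπ cP cX cY hcX hcY col hcol hccol hfin h₁ h₂ hw₁ hw₂ hXfg hXt fd hfd fy harch
  rwa [hab, lengthAt_quotient_span_mul_of_not_mem hs Gp _ rfl] at h

end InequalityRoadCrux

end Summit.BirchSwinnertonDyer.BirchSwinnertonDyer.Theorems.AlignedTransportAtTwoFineRoad

end
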